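import Summits.BirchSwinnertonDyer.BirchSwinnertonDyer.Theorems.KolyvaginRoadThreeZhangTriangulation
import Mathlib.RingTheory.Finiteness.Finsupp
import HarnessLib

/-!
# Route `KolyvaginRoadThree`, deciding crux `ZhangSharpFrameAtThreeHL` (item stmt-BirchSwinnertonDyer-19574):
# W. Zhang's Lemma 8.4 (1)+(3) WITHOUT a finiteness hypothesis on the relaxed Selmer group — the relaxed space at the
# base locus is PROVED finite-dimensional (cell `bsd-stepL`, seat `bsd-stepL-zhang3-p1` g8; `--supports 19574`, helper)

HONEST FRAMING. Pure linear algebra over an arbitrary field `F`; nothing about elliptic curves, Heegner points, level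
raising or `p = 3` is asserted; every number-theoretic input is an explicitly named HYPOTHESIS SHAPE, exactly those of
`ZhangTriangulation.triangulation_at` (koly3b g3, p481938) MINUS ONE; 0 definitions, 0 named facts, 0 `sorry`.
PARTITION: O2@3 (B10) × A1 × crux 19574 × stub S2 `stub_inductionRankGeThreeAtThree` (its (A3) ∕ engine-of-Kolyvagin-
system kit) — none (composition-engine input repaired; types nothing, closes nothing; T7).

THE POINT. koly3b's derivation of the METHOD engine's axiom shape (A3) (W. Zhang, Camb. J. Math. 2 (2014), Lemma 8.4
(1)+(3)) from Kolyvagin-system axioms — `ZhangTriangulation.triangulation_at` ∕ `triangulation`, consumed by the engine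
`exists_ne_zero_of_zhangInduction_on_of_kolyvaginSystem` (p483236) — takes as HYPOTHESIS
`hfin : ∀ s, FiniteDimensional F (SelRel s)` (finiteness of the Selmer group RELAXED AT THE BASE LOCUS `B(κ)`), and
the engine asks it for EVERY relaxation set (`∀ n S s, FiniteDimensional F (SelRel n S s)`). In the model of the
registered skeleton (`Method2.SelRelQ W K c n S s ⊂ H¹(K, E[3])`: no condition above `S`) that binder is FALSE as
soon as `S` is infinite (relaxing `E[3]`-classes at infinitely many good unipotent-admissible places gives an
infinite-dimensional space — Tate's Euler characteristic + Poitou–Tate; the cell's finding (R1) of 2026-08-26,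
`HOME/zhang3/STUB-MISSTATED-19574-method2.md`), and Zhang's base locus `B(κ) = {q : loc_q κ = 0}` (Def. 8.3) is not
known to be finite — so, as typed, the engine-of-KS could never be instantiated. The source needs no such
hypothesis: the proof of Lemma 8.4 (3) (pp. 238–239) SHOWS that finitely many localisations at the diagonal
Kolyvagin primes `ℓ_{ν+1}, …`, each valued on a LINE (`H¹_fin(K_ℓ, V)^±`), are JOINTLY INJECTIVE on the relaxed space
of either sign («Contradiction! Hence c = 0»; «by a dimension counting, there exists a class 0 ≠ d … to get a
contradiction») — and such a space is finite-dimensional. This file proves that and re-issues Lemma 8.4 (1)+(3)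
with the finiteness of BOTH relaxed eigenspaces as a CONCLUSION: §1 the linear algebra (a filtration by
localisation kernels with line-valued steps and finite ∕ trivial bottom is finite, with the dimension count); §2
sign `ε_ν` (`dim ≤ ν + 1`, joint kernel trivial by koly3b's `eq_zero_of_mem_selRel_of_loc_window_eq_zero`); §3 sign
`−ε_ν` (`eq_zero_of_mem_selRel_not_of_loc_eq_zero` = the injectivity inside koly3b's `finrank_selRel_not_le`;
`dim ≤ ν`); §4 `triangulation_at_finite` ∕ `triangulation_finite` = Lemma 8.4 (1)+(3) ∕ the engine's (A3) shape
(`∃ s d, dim Sel s = d + 1 ∧ Sel s = SelRel s ∧ FiniteDimensional (SelRel (¬s)) ∧ dim SelRel (¬s) ≤ d`, verbatim the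
`hA3` of `ZhangInductionOnPos.exists_ne_zero_of_zhangInduction_on_pos`) with NO finiteness input. The companion
`KolyvaginRoadThreeZhangInductionOfKolyvaginSystemFinite.lean` re-issues the engine-of-KS without `hfin`.
CONDITIONAL on every remaining input shape; uniform in `F`; nothing is booked.

References: [cite: WZhang2014, Def. 8.3, Lemma 8.4 (1)–(3) and proof pp. 236–239] [cite: McCallumLMS1991, Prop. 3.1,
Lemma 5.3] [cite: MilneADT2006, Ch. I, Thm. 4.10 (for the model: why relaxed spaces at infinite sets are infinite)]. -/

namespace Summit.BirchSwinnertonDyer.Rank1Residual.X11b.Three.Koly.ZhangTriangulation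

open Module Finset

variable {F : Type*} [Field F] {H : Type*} [AddCommGroup H] [Module F H]

/-! ## §1 Linear algebra: finiteness along a filtration by localisation kernels -/

/-- **A subspace mapped to a line with finite-dimensional kernel is finite-dimensional**: if `loc₀` takes values on
the line through `e` on `K` and its kernel on `K` lies in a finite-dimensional `K'`, then `K` is finite-dimensional —
the finiteness companion of koly3b's `finrank_le_one_add_of_line`. [cite: WZhang2014, proof of Lemma 8.4 (3), p. 239] -/
theorem finiteDimensional_of_line_of_ker {T : Type*} [AddCommGroup T] [Module F T] (loc₀ : H →ₗ[F] T)
    (K K' : Submodule F H) [FiniteDimensional F K'] (e : T)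
    (hline : ∀ x ∈ K, ∃ a : F, loc₀ x = a • e) (hker : ∀ x ∈ K, loc₀ x = 0 → x ∈ K') :
    FiniteDimensional F K := by
  have hmap : K.map loc₀ ≤ Submodule.span F {e} := by
    rintro _ ⟨x, hx, rfl⟩
    obtain ⟨a, ha⟩ := hline x hx
    rw [ha]
    exact Submodule.smul_mem _ a (Submodule.mem_span_singleton_self e)
  have h1 : (K.map loc₀).FG :=
    (Submodule.fg_iff_finiteDimensional _).2 (Submodule.finiteDimensional_of_le hmap)
  have hkerle : K ⊓ LinearMap.ker loc₀ ≤ K' := fun x hx ↦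
    hker x (Submodule.mem_inf.mp hx).1 (LinearMap.mem_ker.mp (Submodule.mem_inf.mp hx).2)
  have h2 : (K ⊓ LinearMap.ker loc₀).FG :=
    (Submodule.fg_iff_finiteDimensional _).2 (Submodule.finiteDimensional_of_le hkerle)
  exact (Submodule.fg_iff_finiteDimensional _).1 (Submodule.fg_of_fg_map_of_fg_inf_ker loc₀ h1 h2)

variable {P : Type*} {Hv : P → Type*} [∀ v, AddCommGroup (Hv v)] [∀ v, Module F (Hv v)]

/-- One step down the kernel filtration: `x ∈ V ∩ ⋂_{j<k} ker loc_{v j}` with `loc_{v k} x = 0` lies one stage lower.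
[folklore] -/
theorem mem_inf_iInf_ker_succ (loc : (v : P) → H →ₗ[F] Hv v) (V : Submodule F H) (v : ℕ → P) (k : ℕ)
    {x : H} (hx : x ∈ V ⊓ ⨅ (j : ℕ) (_ : j < k), LinearMap.ker (loc (v j))) (hx0 : loc (v k) x = 0) :
    x ∈ V ⊓ ⨅ (j : ℕ) (_ : j < k + 1), LinearMap.ker (loc (v j)) := by
  refine Submodule.mem_inf.mpr ⟨(Submodule.mem_inf.mp hx).1, ?_⟩
  refine (Submodule.mem_iInf _).mpr fun j ↦ (Submodule.mem_iInf _).mpr fun hj ↦ ?_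
  rcases Nat.lt_succ_iff_lt_or_eq.mp hj with hj | rfl
  · exact (Submodule.mem_iInf _).mp ((Submodule.mem_iInf _).mp (Submodule.mem_inf.mp hx).2 j) hj
  · exact LinearMap.mem_ker.mpr hx0

/-- **Finiteness and dimension count along a filtration by localisation kernels**: if on `V` each `loc (v j)`,
`j < k`, takes values on the line through `e j` and the joint kernel `V ∩ ⋂_{j<k} ker loc_{v j}` is finite-dimensional,
then `V` is finite-dimensional and `dim V ≤ k + dim (joint kernel)` — koly3b's `finrank_le_add_finrank_inf_iInf_ker`
with the finiteness of `V` moved to the conclusion. [cite: WZhang2014, proof of Lemma 8.4 (3), pp. 238–239] -/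
theorem finite_and_finrank_le_add_of_lines (loc : (v : P) → H →ₗ[F] Hv v) (V : Submodule F H)
    (v : ℕ → P) (e : (j : ℕ) → Hv (v j)) :
    ∀ k : ℕ, (∀ j < k, ∀ x ∈ V, ∃ a : F, loc (v j) x = a • e j) →
      FiniteDimensional F ↥(V ⊓ ⨅ (j : ℕ) (_ : j < k), LinearMap.ker (loc (v j))) →
      FiniteDimensional F V ∧
        finrank F V ≤ k + finrank F ↥(V ⊓ ⨅ (j : ℕ) (_ : j < k), LinearMap.ker (loc (v j))) := by
  intro k
  induction k with
  | zero =>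
    intro _ hfin
    have hle : V ≤ V ⊓ ⨅ (j : ℕ) (_ : j < 0), LinearMap.ker (loc (v j)) :=
      le_inf le_rfl (le_iInf₂ fun j hj ↦ absurd hj (Nat.not_lt_zero j))
    haveI := hfin
    have hV : FiniteDimensional F V := Submodule.finiteDimensional_of_le hle
    exact ⟨hV, by rw [zero_add]; exact Submodule.finrank_mono hle⟩
  | succ k ih =>
    intro hline hfin
    haveI := hfin
    -- the k-th stage is finite: `loc (v k)` maps it to the line `e k`, with kernel the (k+1)-st stage
    have hWk : FiniteDimensional F ↥(V ⊓ ⨅ (j : ℕ) (_ : j < k), LinearMap.ker (loc (v j))) :=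
      finiteDimensional_of_line_of_ker (loc (v k)) _
        (V ⊓ ⨅ (j : ℕ) (_ : j < k + 1), LinearMap.ker (loc (v j))) (e k)
        (fun x hx ↦ hline k (Nat.lt_succ_self k) x (Submodule.mem_inf.mp hx).1)
        (fun x hx hx0 ↦ mem_inf_iInf_ker_succ loc V v k hx hx0)
    obtain ⟨hV, hk⟩ := ih (fun j hj ↦ hline j (Nat.lt_succ_of_lt hj)) hWk
    have hstep : finrank F ↥(V ⊓ ⨅ (j : ℕ) (_ : j < k), LinearMap.ker (loc (v j))) ≤
        1 + finrank F ↥(V ⊓ ⨅ (j : ℕ) (_ : j < k + 1), LinearMap.ker (loc (v j))) :=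
      finrank_le_one_add_of_line (loc (v k)) _ _ (e k)
        (fun x hx ↦ hline k (Nat.lt_succ_self k) x (Submodule.mem_inf.mp hx).1)
        (fun x hx hx0 ↦ mem_inf_iInf_ker_succ loc V v k hx hx0)
    exact ⟨hV, by omega⟩

/-- **Jointly injective line-valued localisations ⟹ finite-dimensional of dimension at most their number** (`V`
with `k` line-valued `loc (v j)` of trivial joint kernel has `dim V ≤ k`). [cite: WZhang2014, proof of Lemma 8.4 (3)] -/
theorem finite_and_finrank_le_of_lines_of_eq_bot (loc : (v : P) → H →ₗ[F] Hv v) (V : Submodule F H)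
    (v : ℕ → P) (e : (j : ℕ) → Hv (v j)) (k : ℕ)
    (hline : ∀ j < k, ∀ x ∈ V, ∃ a : F, loc (v j) x = a • e j)
    (hbot : (V ⊓ ⨅ (j : ℕ) (_ : j < k), LinearMap.ker (loc (v j))) = ⊥) :
    FiniteDimensional F V ∧ finrank F V ≤ k := by
  have hfin : FiniteDimensional F ↥(V ⊓ ⨅ (j : ℕ) (_ : j < k), LinearMap.ker (loc (v j))) := by
    rw [hbot]; infer_instance
  obtain ⟨hV, hk⟩ := finite_and_finrank_le_add_of_lines loc V v e k hline hfin
  rw [hbot, finrank_bot, add_zero] at hk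
  exact ⟨hV, hk⟩

/-- From a property at `ε` and at `¬ε` to the property at every Boolean. [folklore] -/
theorem forall_bool_of_apply_of_apply_not {p : Bool → Prop} (ε : Bool) (h₁ : p ε) (h₂ : p (!ε)) : ∀ s, p s := by
  intro s; cases ε <;> cases s <;> assumption

/-! ## §2 Sign `ε_ν`: the relaxed Selmer group at the base locus is finite, of dimension `≤ ν + 1`

From here on the data of a Kolyvagin system at one fixed level, with the hypothesis names of koly3b's files
(`hfs` = (8.1) as used, `hcL` ∕ `hcT` = property (1) off ∕ on the support, `hB` = every class vanishes on `B`). -/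

variable {ι : Type*}

/-- **`Sel^{ε_ν}_{B}` is finite-dimensional, `dim ≤ ν + 1`** (Zhang p. 238: a relaxed class with `loc_{ℓ_{ν+j}} c = 0`,
`1 ≤ j ≤ ν + 1`, vanishes — koly3b's `eq_zero_of_mem_selRel_of_loc_window_eq_zero` — and these `ν + 1` localisations
are valued on lines). Data: the configuration `f` of Lemma 8.4 (2) with its non-zero diagonal. NO finiteness input.
[cite: WZhang2014, Lemma 8.4 (3), proof p. 238–239] [cite: McCallumLMS1991, Prop. 3.1] -/
theorem finite_selRel_of_configuration [DecidableEq ι] [DecidableEq P] (E : Bool → Submodule F H)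
    (loc : (v : P) → H →ₗ[F] Hv v) (b : (v : P) → Hv v →ₗ[F] Hv v →ₗ[F] F) (L : (v : P) → Submodule F (Hv v))
    (pl : ι → P) (Fv Tv : (ℓ : ι) → Submodule F (Hv (pl ℓ))) (c : Finset ι → H) (ε₀ : Bool)
    (B : Set P) (SelRel : Bool → Submodule F H)
    (hSelRel : ∀ (s : Bool) (x : H), x ∈ SelRel s ↔ x ∈ E s ∧ ∀ v, v ∉ B → loc v x ∈ L v)
    (hB : ∀ v ∈ B, ∀ m : Finset ι, loc v (c m) = 0)
    (hpl : Function.Injective pl)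
    (hLF : ∀ ℓ, L (pl ℓ) = Fv ℓ)
    (hisoL : ∀ (v : P), ∀ x ∈ L v, ∀ y ∈ L v, b v x y = 0)
    (hperf : ∀ (ℓ : ι) (s : Bool), ∀ x ∈ E s, ∀ y ∈ E s, loc (pl ℓ) x ∈ Fv ℓ → loc (pl ℓ) x ≠ 0 →
      loc (pl ℓ) y ∈ Tv ℓ → loc (pl ℓ) y ≠ 0 → b (pl ℓ) (loc (pl ℓ) x) (loc (pl ℓ) y) ≠ 0)
    (hline : ∀ (ℓ : ι) (s : Bool), ∃ e : Hv (pl ℓ), ∀ x ∈ E s, loc (pl ℓ) x ∈ Fv ℓ →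
      ∃ a : F, loc (pl ℓ) x = a • e)
    (hrec : ∀ (x y : H) (T : Finset P), (∀ v, v ∉ T → b v (loc v x) (loc v y) = 0) →
      ∑ v ∈ T, b v (loc v x) (loc v y) = 0)
    (hcE : ∀ m : Finset ι, c m ∈ E (ε₀ ^^ Nat.bodd m.card))
    (hcL : ∀ (m : Finset ι) (v : P), (∀ ℓ ∈ m, pl ℓ ≠ v) → loc v (c m) ∈ L v)
    (hcT : ∀ (m : Finset ι), ∀ ℓ ∈ m, loc (pl ℓ) (c m) ∈ Tv ℓ)
    (hfs : ∀ (m : Finset ι) (ℓ : ι), ℓ ∉ m → (loc (pl ℓ) (c (insert ℓ m)) = 0 ↔ loc (pl ℓ) (c m) = 0))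
    (hCheb2 : ∀ (s : Bool), ∀ x ∈ E s, ∀ y ∈ E (!s), x ≠ 0 → y ≠ 0 → ∀ S : Finset ι,
      ∃ ℓ, ℓ ∉ S ∧ loc (pl ℓ) x ≠ 0 ∧ loc (pl ℓ) y ≠ 0)
    {ν : ℕ} {f : ℕ → ι} (hf : Set.InjOn f (Set.Iio (2 * ν + 1)))
    (hdiag : ∀ i ≤ ν, loc (pl (f (ν + i))) (c ((Finset.Ico i (ν + i)).image f)) ≠ 0) :
    FiniteDimensional F (SelRel (ε₀ ^^ Nat.bodd ν)) ∧ finrank F (SelRel (ε₀ ^^ Nat.bodd ν)) ≤ ν + 1 := by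
  have hoffB : ∀ i ≤ ν, pl (f (ν + i)) ∉ B := fun i hi h ↦ hdiag i hi (hB _ h _)
  choose e he using hline
  refine finite_and_finrank_le_of_lines_of_eq_bot loc (SelRel (ε₀ ^^ Nat.bodd ν))
    (fun j ↦ pl (f (ν + j))) (fun j ↦ e (f (ν + j)) (ε₀ ^^ Nat.bodd ν)) (ν + 1) (fun j hj x hx ↦ ?_) ?_
  · exact he (f (ν + j)) _ x ((hSelRel _ _).mp hx).1
      (by rw [← hLF]; exact ((hSelRel _ _).mp hx).2 _ (hoffB j (Nat.lt_succ_iff.mp hj)))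
  · refine (Submodule.eq_bot_iff _).mpr fun x hx ↦ ?_
    refine eq_zero_of_mem_selRel_of_loc_window_eq_zero E loc b L pl Fv Tv c ε₀ B SelRel hSelRel hB hpl hLF hisoL
      hperf hrec hcE hcL hcT hfs hCheb2 hf (hdiag ν le_rfl) (Submodule.mem_inf.mp hx).1 fun j hj ↦ ?_
    exact LinearMap.mem_ker.mp
      ((Submodule.mem_iInf _).mp ((Submodule.mem_iInf _).mp (Submodule.mem_inf.mp hx).2 j) (Nat.lt_succ_iff.mpr hj))

/-! ## §3 Sign `−ε_ν`: the relaxed Selmer group at the base locus is finite, of dimension `≤ ν` -/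

/-- **A relaxed class of sign `−ε_ν` killed by `loc_{ℓ_{ν+1}}, …, loc_{ℓ_{2ν}}` is zero** (Zhang p. 239: «a class
`0 ≠ d ∈ Sel⁻_{p,B(κ)}` such that `loc_{ℓ_{ν+i}} d = 0`, `1 ≤ i ≤ ν` … we calculate the Tate pairing … to get a
contradiction»): Lemma 8.1 re-chooses `ℓ*` outside the configuration seeing `d` and `c(n_{ν+1})`; pairing `d` with
`c(n_{ν+1} ℓ*)` leaves exactly one non-zero local term, at `ℓ*`, against reciprocity. The injectivity inside koly3b's
`finrank_selRel_not_le`, WITHOUT its finiteness instance (adapted from `KolyvaginRoadThreeZhangTriangulation.lean`).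
[cite: WZhang2014, Lemma 8.4 (3) and proof p. 239] [cite: McCallumLMS1991, Prop. 3.1] -/
theorem eq_zero_of_mem_selRel_not_of_loc_eq_zero [DecidableEq ι] [DecidableEq P] (E : Bool → Submodule F H)
    (loc : (v : P) → H →ₗ[F] Hv v) (b : (v : P) → Hv v →ₗ[F] Hv v →ₗ[F] F) (L : (v : P) → Submodule F (Hv v))
    (pl : ι → P) (Fv Tv : (ℓ : ι) → Submodule F (Hv (pl ℓ))) (c : Finset ι → H) (ε₀ : Bool)
    (B : Set P) (SelRel : Bool → Submodule F H)
    (hSelRel : ∀ (s : Bool) (x : H), x ∈ SelRel s ↔ x ∈ E s ∧ ∀ v, v ∉ B → loc v x ∈ L v)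
    (hB : ∀ v ∈ B, ∀ m : Finset ι, loc v (c m) = 0)
    (hpl : Function.Injective pl)
    (hLF : ∀ ℓ, L (pl ℓ) = Fv ℓ)
    (hisoL : ∀ (v : P), ∀ x ∈ L v, ∀ y ∈ L v, b v x y = 0)
    (hperf : ∀ (ℓ : ι) (s : Bool), ∀ x ∈ E s, ∀ y ∈ E s, loc (pl ℓ) x ∈ Fv ℓ → loc (pl ℓ) x ≠ 0 →
      loc (pl ℓ) y ∈ Tv ℓ → loc (pl ℓ) y ≠ 0 → b (pl ℓ) (loc (pl ℓ) x) (loc (pl ℓ) y) ≠ 0)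
    (hrec : ∀ (x y : H) (T : Finset P), (∀ v, v ∉ T → b v (loc v x) (loc v y) = 0) →
      ∑ v ∈ T, b v (loc v x) (loc v y) = 0)
    (hcE : ∀ m : Finset ι, c m ∈ E (ε₀ ^^ Nat.bodd m.card))
    (hcL : ∀ (m : Finset ι) (v : P), (∀ ℓ ∈ m, pl ℓ ≠ v) → loc v (c m) ∈ L v)
    (hcT : ∀ (m : Finset ι), ∀ ℓ ∈ m, loc (pl ℓ) (c m) ∈ Tv ℓ)
    (hfs : ∀ (m : Finset ι) (ℓ : ι), ℓ ∉ m → (loc (pl ℓ) (c (insert ℓ m)) = 0 ↔ loc (pl ℓ) (c m) = 0))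
    (hCheb2 : ∀ (s : Bool), ∀ x ∈ E s, ∀ y ∈ E (!s), x ≠ 0 → y ≠ 0 → ∀ S : Finset ι,
      ∃ ℓ, ℓ ∉ S ∧ loc (pl ℓ) x ≠ 0 ∧ loc (pl ℓ) y ≠ 0)
    {ν : ℕ} {f : ℕ → ι} (hf : Set.InjOn f (Set.Iio (2 * ν + 1)))
    (hdiag : ∀ i ≤ ν, loc (pl (f (ν + i))) (c ((Finset.Ico i (ν + i)).image f)) ≠ 0)
    {d : H} (hdV : d ∈ SelRel (!(ε₀ ^^ Nat.bodd ν))) (hdker : ∀ j < ν, loc (pl (f (ν + j))) d = 0) :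
    d = 0 := by
  by_contra hd0'
  have hdE : d ∈ E (!(ε₀ ^^ Nat.bodd ν)) := ((hSelRel _ _).mp hdV).1
  -- y = c(n_{ν+1}) of sign ε, non-zero
  have hyE : c ((Finset.Ico ν (ν + ν)).image f) ∈ E (!!(ε₀ ^^ Nat.bodd ν)) := by
    rw [Bool.not_not]
    have hcw : ((Finset.Ico ν (ν + ν)).image f).card = ν := card_window hf (by omega)
    have := hcE ((Finset.Ico ν (ν + ν)).image f)
    rwa [hcw] at this
  have hy0 : c ((Finset.Ico ν (ν + ν)).image f) ≠ 0 := fun h ↦ by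
    have := hdiag ν le_rfl
    rw [h, map_zero] at this
    exact this rfl
  -- Lemma 8.1: re-choose ℓ* outside f 0, …, f (2ν - 1)
  obtain ⟨ℓ', hℓ'S, hℓ'd, hℓ'y⟩ := hCheb2 _ d hdE _ hyE hd0' hy0 ((Finset.range (ν + ν)).image f)
  have hℓ'W : ℓ' ∉ (Finset.Ico ν (ν + ν)).image f := by
    intro h
    obtain ⟨t, ht, rfl⟩ := Finset.mem_image.mp h
    exact hℓ'S (Finset.mem_image.mpr ⟨t, Finset.mem_range.mpr (Finset.mem_Ico.mp ht).2, rfl⟩)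
  set nS : Finset ι := insert ℓ' ((Finset.Ico ν (ν + ν)).image f) with hnS
  have hnSE : c nS ∈ E (!(ε₀ ^^ Nat.bodd ν)) := by
    have := hcE nS
    rwa [hnS, Finset.card_insert_of_notMem hℓ'W, card_window hf (by omega), sign_succ] at this
  have hyℓ' : loc (pl ℓ') (c nS) ≠ 0 := fun h ↦ hℓ'y ((hfs _ _ hℓ'W).mp h)
  have hℓ'B : pl ℓ' ∉ B := fun h ↦ hℓ'y (hB _ h _)
  have hdℓ'L : loc (pl ℓ') d ∈ Fv ℓ' := by rw [← hLF]; exact ((hSelRel _ _).mp hdV).2 _ hℓ'B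
  have hterm : b (pl ℓ') (loc (pl ℓ') d) (loc (pl ℓ') (c nS)) ≠ 0 :=
    hperf ℓ' _ d hdE _ hnSE hdℓ'L hℓ'd (hcT _ ℓ' (Finset.mem_insert_self _ _)) hyℓ'
  have hsum : ∑ ℓ ∈ nS, b (pl ℓ) (loc (pl ℓ) d) (loc (pl ℓ) (c nS)) = 0 := by
    refine sum_pairing_eq_zero loc b pl hpl hrec d _ nS fun v hv ↦ ?_
    by_cases hvB : v ∈ B
    · rw [hB v hvB nS, map_zero]
    · exact hisoL v _ (((hSelRel _ _).mp hdV).2 v hvB) _ (hcL nS v hv)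
  rw [Finset.sum_eq_single ℓ'] at hsum
  · exact hterm hsum
  · intro ℓ hℓ hne
    rw [hnS, Finset.mem_insert] at hℓ
    rcases hℓ with h | h
    · exact absurd h hne
    obtain ⟨t, ht, rfl⟩ := Finset.mem_image.mp h
    obtain ⟨j, hj, rfl⟩ : ∃ j < ν, t = ν + j :=
      ⟨t - ν, by have := Finset.mem_Ico.mp ht; omega, by have := Finset.mem_Ico.mp ht; omega⟩
    rw [hdker j hj, map_zero, LinearMap.zero_apply]
  · intro h
    exact absurd (Finset.mem_insert_self _ _) h

/-- **`Sel^{−ε_ν}_{B}` is finite-dimensional, `dim ≤ ν`** (Lemma 8.4 (3), second clause, with NO finiteness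
hypothesis): the `ν` localisations `loc_{ℓ_{ν+1}}, …, loc_{ℓ_{2ν}}` are valued on lines and jointly injective on it
(`eq_zero_of_mem_selRel_not_of_loc_eq_zero`). [cite: WZhang2014, Lemma 8.4 (3) and proof p. 239] -/
theorem finite_selRel_not_of_configuration [DecidableEq ι] [DecidableEq P] (E : Bool → Submodule F H)
    (loc : (v : P) → H →ₗ[F] Hv v) (b : (v : P) → Hv v →ₗ[F] Hv v →ₗ[F] F) (L : (v : P) → Submodule F (Hv v))
    (pl : ι → P) (Fv Tv : (ℓ : ι) → Submodule F (Hv (pl ℓ))) (c : Finset ι → H) (ε₀ : Bool)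
    (B : Set P) (SelRel : Bool → Submodule F H)
    (hSelRel : ∀ (s : Bool) (x : H), x ∈ SelRel s ↔ x ∈ E s ∧ ∀ v, v ∉ B → loc v x ∈ L v)
    (hB : ∀ v ∈ B, ∀ m : Finset ι, loc v (c m) = 0)
    (hpl : Function.Injective pl)
    (hLF : ∀ ℓ, L (pl ℓ) = Fv ℓ)
    (hisoL : ∀ (v : P), ∀ x ∈ L v, ∀ y ∈ L v, b v x y = 0)
    (hperf : ∀ (ℓ : ι) (s : Bool), ∀ x ∈ E s, ∀ y ∈ E s, loc (pl ℓ) x ∈ Fv ℓ → loc (pl ℓ) x ≠ 0 →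
      loc (pl ℓ) y ∈ Tv ℓ → loc (pl ℓ) y ≠ 0 → b (pl ℓ) (loc (pl ℓ) x) (loc (pl ℓ) y) ≠ 0)
    (hline : ∀ (ℓ : ι) (s : Bool), ∃ e : Hv (pl ℓ), ∀ x ∈ E s, loc (pl ℓ) x ∈ Fv ℓ →
      ∃ a : F, loc (pl ℓ) x = a • e)
    (hrec : ∀ (x y : H) (T : Finset P), (∀ v, v ∉ T → b v (loc v x) (loc v y) = 0) →
      ∑ v ∈ T, b v (loc v x) (loc v y) = 0)
    (hcE : ∀ m : Finset ι, c m ∈ E (ε₀ ^^ Nat.bodd m.card))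
    (hcL : ∀ (m : Finset ι) (v : P), (∀ ℓ ∈ m, pl ℓ ≠ v) → loc v (c m) ∈ L v)
    (hcT : ∀ (m : Finset ι), ∀ ℓ ∈ m, loc (pl ℓ) (c m) ∈ Tv ℓ)
    (hfs : ∀ (m : Finset ι) (ℓ : ι), ℓ ∉ m → (loc (pl ℓ) (c (insert ℓ m)) = 0 ↔ loc (pl ℓ) (c m) = 0))
    (hCheb2 : ∀ (s : Bool), ∀ x ∈ E s, ∀ y ∈ E (!s), x ≠ 0 → y ≠ 0 → ∀ S : Finset ι,
      ∃ ℓ, ℓ ∉ S ∧ loc (pl ℓ) x ≠ 0 ∧ loc (pl ℓ) y ≠ 0)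
    {ν : ℕ} {f : ℕ → ι} (hf : Set.InjOn f (Set.Iio (2 * ν + 1)))
    (hdiag : ∀ i ≤ ν, loc (pl (f (ν + i))) (c ((Finset.Ico i (ν + i)).image f)) ≠ 0) :
    FiniteDimensional F (SelRel (!(ε₀ ^^ Nat.bodd ν))) ∧ finrank F (SelRel (!(ε₀ ^^ Nat.bodd ν))) ≤ ν := by
  have hoffB : ∀ i ≤ ν, pl (f (ν + i)) ∉ B := fun i hi h ↦ hdiag i hi (hB _ h _)
  choose e he using hline
  refine finite_and_finrank_le_of_lines_of_eq_bot loc (SelRel (!(ε₀ ^^ Nat.bodd ν)))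
    (fun j ↦ pl (f (ν + j))) (fun j ↦ e (f (ν + j)) (!(ε₀ ^^ Nat.bodd ν))) ν (fun j hj x hx ↦ ?_) ?_
  · exact he (f (ν + j)) _ x ((hSelRel _ _).mp hx).1
      (by rw [← hLF]; exact ((hSelRel _ _).mp hx).2 _ (hoffB j (le_of_lt hj)))
  · refine (Submodule.eq_bot_iff _).mpr fun x hx ↦ ?_
    exact eq_zero_of_mem_selRel_not_of_loc_eq_zero E loc b L pl Fv Tv c ε₀ B SelRel hSelRel hB hpl hLF hisoL hperf
      hrec hcE hcL hcT hfs hCheb2 hf hdiag (Submodule.mem_inf.mp hx).1 fun j hj ↦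
        LinearMap.mem_ker.mp ((Submodule.mem_iInf _).mp ((Submodule.mem_iInf _).mp (Submodule.mem_inf.mp hx).2 j) hj)

/-! ## §4 Lemma 8.4 (1)+(3) ∕ the (A3) shape with NO finiteness hypothesis -/

/-- **Zhang's Lemma 8.4 (1)+(3) at the vanishing order `ν`, finiteness PROVED.** Input shapes exactly as in
koly3b's `triangulation_at` EXCEPT that `hfin : ∀ s, FiniteDimensional F (SelRel s)` is GONE (`B` of any size). If
some class on `ν` primes is non-zero and every class on fewer primes vanishes, then with `ε = ε₀ ^^ Nat.bodd ν`: BOTH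
`SelRel ε` and `SelRel (¬ε)` are finite-dimensional, `dim Sel ε = ν + 1`, `Sel ε = SelRel ε`, `dim SelRel (¬ε) ≤ ν`.
Proof: `exists_configuration`, §2 and §3, then koly3b's `triangulation_at`. CONDITIONAL on every input shape.
[cite: WZhang2014, Lemma 8.4 (1)–(3), pp. 236–239] [cite: McCallumLMS1991, Prop. 3.1, Lemma 5.3] -/
theorem triangulation_at_finite [DecidableEq ι] [DecidableEq P] (E : Bool → Submodule F H)
    (loc : (v : P) → H →ₗ[F] Hv v) (b : (v : P) → Hv v →ₗ[F] Hv v →ₗ[F] F) (L : (v : P) → Submodule F (Hv v))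
    (pl : ι → P) (Fv Tv : (ℓ : ι) → Submodule F (Hv (pl ℓ))) (c : Finset ι → H) (ε₀ : Bool)
    (B : Set P) (Sel SelRel : Bool → Submodule F H)
    (hSel : ∀ (s : Bool) (x : H), x ∈ Sel s ↔ x ∈ E s ∧ ∀ v, loc v x ∈ L v)
    (hSelRel : ∀ (s : Bool) (x : H), x ∈ SelRel s ↔ x ∈ E s ∧ ∀ v, v ∉ B → loc v x ∈ L v)
    (hB : ∀ v ∈ B, ∀ m : Finset ι, loc v (c m) = 0)
    (hpl : Function.Injective pl)
    (hLF : ∀ ℓ, L (pl ℓ) = Fv ℓ)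
    (hisoL : ∀ (v : P), ∀ x ∈ L v, ∀ y ∈ L v, b v x y = 0)
    (hisoT : ∀ (ℓ : ι), ∀ x ∈ Tv ℓ, ∀ y ∈ Tv ℓ, b (pl ℓ) x y = 0)
    (hperf : ∀ (ℓ : ι) (s : Bool), ∀ x ∈ E s, ∀ y ∈ E s, loc (pl ℓ) x ∈ Fv ℓ → loc (pl ℓ) x ≠ 0 →
      loc (pl ℓ) y ∈ Tv ℓ → loc (pl ℓ) y ≠ 0 → b (pl ℓ) (loc (pl ℓ) x) (loc (pl ℓ) y) ≠ 0)
    (hline : ∀ (ℓ : ι) (s : Bool), ∃ e : Hv (pl ℓ), ∀ x ∈ E s, loc (pl ℓ) x ∈ Fv ℓ →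
      ∃ a : F, loc (pl ℓ) x = a • e)
    (hrec : ∀ (x y : H) (T : Finset P), (∀ v, v ∉ T → b v (loc v x) (loc v y) = 0) →
      ∑ v ∈ T, b v (loc v x) (loc v y) = 0)
    (hcE : ∀ m : Finset ι, c m ∈ E (ε₀ ^^ Nat.bodd m.card))
    (hcL : ∀ (m : Finset ι) (v : P), (∀ ℓ ∈ m, pl ℓ ≠ v) → loc v (c m) ∈ L v)
    (hcT : ∀ (m : Finset ι), ∀ ℓ ∈ m, loc (pl ℓ) (c m) ∈ Tv ℓ)
    (hfs : ∀ (m : Finset ι) (ℓ : ι), ℓ ∉ m → (loc (pl ℓ) (c (insert ℓ m)) = 0 ↔ loc (pl ℓ) (c m) = 0))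
    (hCheb1 : ∀ x : H, x ≠ 0 → ∀ S : Finset ι, ∃ ℓ, ℓ ∉ S ∧ loc (pl ℓ) x ≠ 0)
    (hCheb2 : ∀ (s : Bool), ∀ x ∈ E s, ∀ y ∈ E (!s), x ≠ 0 → y ≠ 0 → ∀ S : Finset ι,
      ∃ ℓ, ℓ ∉ S ∧ loc (pl ℓ) x ≠ 0 ∧ loc (pl ℓ) y ≠ 0)
    (hSupply : ∀ (ℓ : ι) (S : Finset ι), ℓ ∉ S → ∀ s : Bool, ∃ x ∈ E s, x ≠ 0 ∧
      (∀ v : P, v ≠ pl ℓ → (∀ ℓ' ∈ S, pl ℓ' ≠ v) → loc v x ∈ L v) ∧ ∀ ℓ' ∈ S, loc (pl ℓ') x ∈ Tv ℓ')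
    {ν : ℕ} (hν : ∃ m : Finset ι, m.card = ν ∧ c m ≠ 0) (hmin : ∀ m : Finset ι, m.card < ν → c m = 0) :
    FiniteDimensional F (SelRel (ε₀ ^^ Nat.bodd ν)) ∧ FiniteDimensional F (SelRel (!(ε₀ ^^ Nat.bodd ν))) ∧
      finrank F (Sel (ε₀ ^^ Nat.bodd ν)) = ν + 1 ∧ Sel (ε₀ ^^ Nat.bodd ν) = SelRel (ε₀ ^^ Nat.bodd ν) ∧
      finrank F (SelRel (!(ε₀ ^^ Nat.bodd ν))) ≤ ν := by
  -- the configuration ℓ₁, …, ℓ_{2ν+1}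
  obtain ⟨f, hf, hdiag⟩ := exists_configuration E loc b L pl Fv Tv c ε₀ hpl hLF hisoL hisoT hperf hrec hcE hcL
    hcT hfs hCheb1 hCheb2 hSupply hν
  have h₁ := (finite_selRel_of_configuration E loc b L pl Fv Tv c ε₀ B SelRel hSelRel hB hpl hLF hisoL hperf hline
    hrec hcE hcL hcT hfs hCheb2 hf hdiag).1
  have h₂ := (finite_selRel_not_of_configuration E loc b L pl Fv Tv c ε₀ B SelRel hSelRel hB hpl hLF hisoL hperf
    hline hrec hcE hcL hcT hfs hCheb2 hf hdiag).1
  have hfin : ∀ s, FiniteDimensional F (SelRel s) :=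
    forall_bool_of_apply_of_apply_not (p := fun s ↦ FiniteDimensional F (SelRel s)) (ε₀ ^^ Nat.bodd ν) h₁ h₂
  exact ⟨h₁, h₂, triangulation_at E loc b L pl Fv Tv c ε₀ B Sel SelRel hSel hSelRel hfin hB hpl hLF hisoL hisoT hperf
    hline hrec hcE hcL hcT hfs hCheb1 hCheb2 hSupply hν hmin⟩

/-- **The axiom shape (A3) TRIANGULATION of the METHOD engine, DERIVED with NO finiteness input** — conclusion
VERBATIM the `hA3` shape of `ZhangInductionOnPos.exists_ne_zero_of_zhangInduction_on_pos` (with `Sel := Sel n`,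
`SelRel := SelRel n (B n)`), INCLUDING `FiniteDimensional F (SelRel (!s))`: if SOME class is non-zero, take `ν` the
vanishing order and apply `triangulation_at_finite`. So (A3) at a level whose classes satisfy the Kolyvagin-system
axioms follows from (REC) + (Cheb) + (Supply) + the local picture at Kolyvagin primes, for a base locus of ANY
size. CONDITIONAL on every input shape; nothing is booked.
[cite: WZhang2014, Lemma 8.4 (1)+(3)] [cite: McCallumLMS1991, Prop. 3.1, Lemma 5.3] -/
theorem triangulation_finite [DecidableEq ι] [DecidableEq P] (E : Bool → Submodule F H)
    (loc : (v : P) → H →ₗ[F] Hv v) (b : (v : P) → Hv v →ₗ[F] Hv v →ₗ[F] F) (L : (v : P) → Submodule F (Hv v))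
    (pl : ι → P) (Fv Tv : (ℓ : ι) → Submodule F (Hv (pl ℓ))) (c : Finset ι → H) (ε₀ : Bool)
    (B : Set P) (Sel SelRel : Bool → Submodule F H)
    (hSel : ∀ (s : Bool) (x : H), x ∈ Sel s ↔ x ∈ E s ∧ ∀ v, loc v x ∈ L v)
    (hSelRel : ∀ (s : Bool) (x : H), x ∈ SelRel s ↔ x ∈ E s ∧ ∀ v, v ∉ B → loc v x ∈ L v)
    (hB : ∀ v ∈ B, ∀ m : Finset ι, loc v (c m) = 0)
    (hpl : Function.Injective pl)
    (hLF : ∀ ℓ, L (pl ℓ) = Fv ℓ)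
    (hisoL : ∀ (v : P), ∀ x ∈ L v, ∀ y ∈ L v, b v x y = 0)
    (hisoT : ∀ (ℓ : ι), ∀ x ∈ Tv ℓ, ∀ y ∈ Tv ℓ, b (pl ℓ) x y = 0)
    (hperf : ∀ (ℓ : ι) (s : Bool), ∀ x ∈ E s, ∀ y ∈ E s, loc (pl ℓ) x ∈ Fv ℓ → loc (pl ℓ) x ≠ 0 →
      loc (pl ℓ) y ∈ Tv ℓ → loc (pl ℓ) y ≠ 0 → b (pl ℓ) (loc (pl ℓ) x) (loc (pl ℓ) y) ≠ 0)
    (hline : ∀ (ℓ : ι) (s : Bool), ∃ e : Hv (pl ℓ), ∀ x ∈ E s, loc (pl ℓ) x ∈ Fv ℓ →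
      ∃ a : F, loc (pl ℓ) x = a • e)
    (hrec : ∀ (x y : H) (T : Finset P), (∀ v, v ∉ T → b v (loc v x) (loc v y) = 0) →
      ∑ v ∈ T, b v (loc v x) (loc v y) = 0)
    (hcE : ∀ m : Finset ι, c m ∈ E (ε₀ ^^ Nat.bodd m.card))
    (hcL : ∀ (m : Finset ι) (v : P), (∀ ℓ ∈ m, pl ℓ ≠ v) → loc v (c m) ∈ L v)
    (hcT : ∀ (m : Finset ι), ∀ ℓ ∈ m, loc (pl ℓ) (c m) ∈ Tv ℓ)
    (hfs : ∀ (m : Finset ι) (ℓ : ι), ℓ ∉ m → (loc (pl ℓ) (c (insert ℓ m)) = 0 ↔ loc (pl ℓ) (c m) = 0))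
    (hCheb1 : ∀ x : H, x ≠ 0 → ∀ S : Finset ι, ∃ ℓ, ℓ ∉ S ∧ loc (pl ℓ) x ≠ 0)
    (hCheb2 : ∀ (s : Bool), ∀ x ∈ E s, ∀ y ∈ E (!s), x ≠ 0 → y ≠ 0 → ∀ S : Finset ι,
      ∃ ℓ, ℓ ∉ S ∧ loc (pl ℓ) x ≠ 0 ∧ loc (pl ℓ) y ≠ 0)
    (hSupply : ∀ (ℓ : ι) (S : Finset ι), ℓ ∉ S → ∀ s : Bool, ∃ x ∈ E s, x ≠ 0 ∧
      (∀ v : P, v ≠ pl ℓ → (∀ ℓ' ∈ S, pl ℓ' ≠ v) → loc v x ∈ L v) ∧ ∀ ℓ' ∈ S, loc (pl ℓ') x ∈ Tv ℓ')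
    (hne : ∃ m : Finset ι, c m ≠ 0) :
    ∃ (s : Bool) (d : ℕ), finrank F (Sel s) = d + 1 ∧ Sel s = SelRel s ∧
      FiniteDimensional F (SelRel (!s)) ∧ finrank F (SelRel (!s)) ≤ d := by
  classical
  -- the vanishing order
  have hex : ∃ k : ℕ, ∃ m : Finset ι, m.card = k ∧ c m ≠ 0 := by
    obtain ⟨m, hm⟩ := hne
    exact ⟨m.card, m, rfl, hm⟩
  refine ⟨ε₀ ^^ Nat.bodd (Nat.find hex), Nat.find hex, ?_⟩
  have hν : ∃ m : Finset ι, m.card = Nat.find hex ∧ c m ≠ 0 := Nat.find_spec hex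
  have hmin : ∀ m : Finset ι, m.card < Nat.find hex → c m = 0 := by
    intro m hm
    by_contra h
    exact Nat.find_min hex hm ⟨m, rfl, h⟩
  obtain ⟨-, h₂, h₃, h₄, h₅⟩ := triangulation_at_finite E loc b L pl Fv Tv c ε₀ B Sel SelRel hSel hSelRel hB hpl hLF
    hisoL hisoT hperf hline hrec hcE hcL hcT hfs hCheb1 hCheb2 hSupply hν hmin
  exact ⟨h₃, h₄, h₂, h₅⟩

end Summit.BirchSwinnertonDyer.Rank1Residual.X11b.Three.Koly.ZhangTriangulation
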